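import Literature.MathematicalPhysics.KineticTheory.HardSphereEulerProofs
import Summits.AtomisticToContinuum.HydrodynamicLimit.Theorems.OneFlightGossipEngineEnergyCurrentTailsLevelCensusObjects
import HarnessLib

/-!
# Energetic collisions have ONE rare pre-collisional participant (pathwise)

Helper file of the crux line `registered` (birth skeleton) of `SpeedCapSurgery.MaxSpeedBoundLog`
(stmt-AtomisticToContinuum-9629): the pathwise half of the route's glue `TailsToMaxSpeedR`
(stmt-16990, "pre- and post-collisional pair energies agree, so an energetic collision has a
PRE-collisional participant faster than `λ/√2` — a ONE-RARE-PARTICIPANT event … the ordered-pair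
collision sum `Σ_{i≠j} ψ(v_i⁻)` of `ContactIntensityDominationOneRare` counts it at least once").

`eventSum_le_oneRareSum`: on a good orbit of a flow of the crux frame (`0 < σ < 1/2`), the
once-per-collision count `eventSum Φ s t {c² < ‖v₁⁺‖² + ‖v₂⁺‖²}` of the collisions in `(s, t]` whose
OUTGOING pair has kinetic energy above `c²` is at most the ordered-pair collision sum of the one-sided
marks `ψ(v_i⁻) · (1 + ‖v_j⁻‖)^k` — the integrand of `ContactIntensityDominationOneRare` (stmt-16939) —
for every `k` and every mark `ψ` with `ψ(v) ≥ 1` whenever `c² < 2‖v‖²`. At a collision time the two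
ordered contact pairs `(p,q)`, `(q,p)` contribute `ψ(v_p⁻)(…) + ψ(v_q⁻)(…)` (the elastic collision of
`(q,p)` is that of `(p,q)` in the regular torus geometry, `collidePair_comm`; the pre-collisional
velocities are those of `collidePair p q` of the post-collisional value), and pair energy is
conserved (`norm_sq_reflectVel_fst_add_norm_sq_reflectVel_snd`), so one of `v_p⁻, v_q⁻` has
`2‖v‖² > c²`.

References: I. Gallagher, L. Saint-Raymond, B. Texier, *From Newton to Boltzmann* (2013) §4.1;
C. Cercignani, R. Illner, M. Pulvirenti, *The Mathematical Theory of Dilute Gases* (1994) App. 4.A.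
-/

noncomputable section

open MeasureTheory Set Filter Topology
open scoped ENNReal InnerProductSpace BigOperators

namespace Summit.AtomisticToContinuum.HydrodynamicLimit.Theorems.MaxSpeedBoundLogLine

open Literature.MathematicalPhysics.KineticTheory Literature.Analysis.FluidPDE
open Summit.AtomisticToContinuum.HydrodynamicLimit.Theorems.EnergyCurrentTailsLevelCensus

/-- Pair energy above `c²` forces one member above `c²/2`. -/
theorem exists_half_of_sq_lt_add {c a b : ℝ} (h : c ^ 2 < a ^ 2 + b ^ 2) :
    c ^ 2 < 2 * a ^ 2 ∨ c ^ 2 < 2 * b ^ 2 := by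
  by_contra hcon
  push Not at hcon
  linarith [hcon.1, hcon.2]

/-- **An energetic collision is counted by the one-rare ordered-pair sum (pathwise).** On a good orbit
of a flow of the crux frame (`0 < σ < 1/2`), for a window `(s, t]`, an exponent `k` and a mark
`ψ : V3 → ℝ≥0∞` with `1 ≤ ψ v` whenever `c² < 2‖v‖²`, the once-per-collision count of the collisions
whose outgoing pair has kinetic energy above `c²` is at most the ordered-pair collision sum of
`𝟙_{contact (i,j)} · ψ(v_i⁻) · (1 + ‖v_j⁻‖)^k`, pre-collisional velocities read off the
post-collisional value through `collidePair` — verbatim the integrand of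
`ContactIntensityDominationOneRare`. -/
theorem eventSum_le_oneRareSum {σ : ℝ} (hσ : 0 < σ) (hσ2 : σ < 1 / 2) {N : ℕ} (Φ : Flow σ N)
    {z : Config (N + 1) (Fin 3) T3} (hz : z ∈ Φ.good) (c s t : ℝ) (k : ℕ) {ψ : V3 → ℝ≥0∞}
    (hψ : ∀ v : V3, c ^ 2 < 2 * ‖v‖ ^ 2 → 1 ≤ ψ v) :
    eventSum Φ s t {q : VelEvent | c ^ 2 < ‖q.2.1‖ ^ 2 + ‖q.2.2‖ ^ 2} z ≤
      ∑ᶠ τ ∈ collisionTimes (Torus.geometry (Fin 3)) (hsDiameter σ N) (fun r => Φ.flow r z) ∩ Set.Ioc s t,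
        ∑ i : Fin (N + 1), ∑ j : Fin (N + 1), if i = j then (0 : ℝ≥0∞) else
          (contactSet (Torus.geometry (Fin 3)) (N + 1) (hsDiameter σ N) i j).indicator
            (fun y => (fun p : V3 × V3 => ψ p.1 * ENNReal.ofReal ((1 + ‖p.2‖) ^ k))
              ((((collidePair (Torus.geometry (Fin 3)) i j y)) i).2,
                (((collidePair (Torus.geometry (Fin 3)) i j y)) j).2))
            (Φ.flow τ z) := by
  classical
  set ε := hsDiameter σ N with hε
  have hεlt : ε < 2⁻¹ := (hsDiameter_le hσ.le N).trans_lt (by norm_num at hσ2 ⊢; linarith)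
  have hG := Torus.isHardSphereRegular_geometry (d := Fin 3) hεlt
  set γ : ℝ → Config (N + 1) (Fin 3) T3 := fun r => Φ.flow r z with hγ
  have htraj : IsHardSphereTrajectory (Torus.geometry (Fin 3)) ε (N + 1) γ := Φ.isTrajectory z hz
  have hfin : (collisionTimes (Torus.geometry (Fin 3)) ε γ ∩ Ioc s t).Finite :=
    htraj.finite_collisionTimes_inter_of_subset_Icc Ioc_subset_Icc_self
  set S : Set VelEvent := {q | c ^ 2 < ‖q.2.1‖ ^ 2 + ‖q.2.2‖ ^ 2} with hS
  -- the one-rare summand, as a function of the configuration and the ordered pair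
  set F : Config (N + 1) (Fin 3) T3 → Fin (N + 1) → Fin (N + 1) → ℝ≥0∞ := fun y i j =>
    if i = j then (0 : ℝ≥0∞) else
      (contactSet (Torus.geometry (Fin 3)) (N + 1) ε i j).indicator
        (fun y => (fun p : V3 × V3 => ψ p.1 * ENNReal.ofReal ((1 + ‖p.2‖) ^ k))
          ((((collidePair (Torus.geometry (Fin 3)) i j y)) i).2,
            (((collidePair (Torus.geometry (Fin 3)) i j y)) j).2)) y with hF
  -- the guarded velocity-event summand
  set E : ℝ → Fin (N + 1) × Fin (N + 1) → ℝ≥0∞ := fun τ p =>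
    if (HardSphereCollisionRecord.ofConfig (Torus.geometry (Fin 3)) ε (γ τ) τ p.1 p.2).fst <
        (HardSphereCollisionRecord.ofConfig (Torus.geometry (Fin 3)) ε (γ τ) τ p.1 p.2).snd then
      S.indicator (fun _ => (1 : ℝ≥0∞))
        ((HardSphereCollisionRecord.ofConfig (Torus.geometry (Fin 3)) ε (γ τ) τ p.1 p.2).preVel,
          (HardSphereCollisionRecord.ofConfig (Torus.geometry (Fin 3)) ε (γ τ) τ p.1 p.2).postVel)
    else 0 with hEdef
  have hlhs : eventSum Φ s t S z = ∑ τ ∈ hfin.toFinset,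
      ∑ p ∈ contactPairs (Torus.geometry (Fin 3)) ε (γ τ), E τ p := by
    rw [eventSum, HardSphereFlow.collisionSum_eq, collisionSum_eq_finset_sum hfin]
  have hrhs : (∑ᶠ τ ∈ collisionTimes (Torus.geometry (Fin 3)) ε γ ∩ Ioc s t,
      ∑ i : Fin (N + 1), ∑ j : Fin (N + 1), F (γ τ) i j) =
      ∑ τ ∈ hfin.toFinset, ∑ i : Fin (N + 1), ∑ j : Fin (N + 1), F (γ τ) i j :=
    finsum_mem_eq_finite_toFinset_sum _ hfin
  -- a single ordered term of the one-rare sum at a contact pair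
  have hFpair : ∀ (y : Config (N + 1) (Fin 3) T3) (p q : Fin (N + 1)), p ≠ q →
      y ∈ contactSet (Torus.geometry (Fin 3)) (N + 1) ε p q →
      ψ (((collidePair (Torus.geometry (Fin 3)) p q y) p).2) ≤ F y p q := by
    intro y p q hpq hc
    simp only [hF, if_neg hpq, indicator_of_mem hc]
    have h1 : (1 : ℝ≥0∞) ≤ ENNReal.ofReal ((1 + ‖((collidePair (Torus.geometry (Fin 3)) p q y) q).2‖) ^ k) := by
      rw [← ENNReal.ofReal_one]
      exact ENNReal.ofReal_le_ofReal (one_le_pow₀ (by linarith [norm_nonneg ((collidePair (Torus.geometry (Fin 3)) p q y q).2)]))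
    calc ψ (((collidePair (Torus.geometry (Fin 3)) p q y) p).2)
        = ψ (((collidePair (Torus.geometry (Fin 3)) p q y) p).2) * 1 := (mul_one _).symm
      _ ≤ _ := by gcongr
  -- per collision time: the guarded count is at most the one-rare double sum
  have hper : ∀ τ ∈ hfin.toFinset,
      ∑ p ∈ contactPairs (Torus.geometry (Fin 3)) ε (γ τ), E τ p ≤
        ∑ i : Fin (N + 1), ∑ j : Fin (N + 1), F (γ τ) i j := by
    intro τ hτ
    have hτ' : τ ∈ collisionTimes (Torus.geometry (Fin 3)) ε γ := ((Set.Finite.mem_toFinset hfin).1 hτ).1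
    obtain ⟨⟨p₀, q₀⟩, hpq₀⟩ := mem_collisionTimes_iff_contactPairs_nonempty.1 hτ'
    -- order the colliding pair with the smaller label first
    obtain ⟨p, q, hpq, hmem⟩ : ∃ p q : Fin (N + 1), p < q ∧
        (p, q) ∈ contactPairs (Torus.geometry (Fin 3)) ε (γ τ) := by
      obtain ⟨hne, hc⟩ := mem_contactPairs.1 hpq₀
      rcases lt_or_gt_of_ne hne with h | h
      · exact ⟨p₀, q₀, h, hpq₀⟩
      · exact ⟨q₀, p₀, h, (swap_mem_contactPairs_iff hG (p := (p₀, q₀))).2 hpq₀⟩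
    obtain ⟨hne, hc⟩ := mem_contactPairs.1 hmem
    have hpairs := htraj.contactPairs_eq_pair hG hmem
    have hc' : γ τ ∈ contactSet (Torus.geometry (Fin 3)) (N + 1) ε q p := (hG.mem_contactSet_comm).1 hc
    -- the left-hand side at `τ`: only the ordered pair `(p, q)` survives the guard
    have hL : ∑ e ∈ contactPairs (Torus.geometry (Fin 3)) ε (γ τ), E τ e = E τ (p, q) := by
      rw [hpairs, Finset.sum_pair (fun h => hne (Prod.mk.inj h).1)]
      have hzero : E τ (q, p) = 0 := by
        simp only [hEdef, HardSphereCollisionRecord.ofConfig_fst, HardSphereCollisionRecord.ofConfig_snd,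
          if_neg (not_lt.2 hpq.le)]
      rw [hzero, add_zero]
    -- the right-hand side at `τ` contains the two ordered terms `(p, q)` and `(q, p)`
    have hR : F (γ τ) p q + F (γ τ) q p ≤ ∑ i : Fin (N + 1), ∑ j : Fin (N + 1), F (γ τ) i j := by
      rw [← Finset.sum_product' Finset.univ Finset.univ (fun i j => F (γ τ) i j),
        ← Finset.sum_pair (f := fun e : Fin (N + 1) × Fin (N + 1) => F (γ τ) e.1 e.2)
          (fun h => hne (Prod.mk.inj h).1)]
      exact Finset.sum_le_sum_of_subset_of_nonneg (fun e _ => Finset.mem_product.2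
        ⟨Finset.mem_univ _, Finset.mem_univ _⟩) (fun _ _ _ => bot_le)
    -- the guarded term is at most `ψ(v_p⁻) + ψ(v_q⁻)`
    have hEle : E τ (p, q) ≤ F (γ τ) p q + F (γ τ) q p := by
      simp only [hEdef, HardSphereCollisionRecord.ofConfig_fst, HardSphereCollisionRecord.ofConfig_snd,
        if_pos hpq]
      by_cases hen : ((HardSphereCollisionRecord.ofConfig (Torus.geometry (Fin 3)) ε (γ τ) τ p q).preVel,
          (HardSphereCollisionRecord.ofConfig (Torus.geometry (Fin 3)) ε (γ τ) τ p q).postVel) ∈ S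
      · rw [indicator_of_mem hen]
        -- energy of the outgoing pair, hence of the incoming pair, exceeds `c²`
        have hpost : c ^ 2 < ‖(γ τ p).2‖ ^ 2 + ‖(γ τ q).2‖ ^ 2 := by
          simpa only [hS, mem_setOf_eq, HardSphereCollisionRecord.ofConfig_postVel] using hen
        have hpre : c ^ 2 < ‖((collidePair (Torus.geometry (Fin 3)) p q (γ τ)) p).2‖ ^ 2 +
            ‖((collidePair (Torus.geometry (Fin 3)) p q (γ τ)) q).2‖ ^ 2 := by
          rw [collidePair_apply_left hne, collidePair_apply_right,
            norm_sq_reflectVel_fst_add_norm_sq_reflectVel_snd]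
          exact hpost
        rcases exists_half_of_sq_lt_add hpre with h1 | h2
        · exact (hψ _ h1).trans ((hFpair (γ τ) p q hne hc).trans le_self_add)
        · have hq : ψ (((collidePair (Torus.geometry (Fin 3)) p q (γ τ)) q).2) ≤ F (γ τ) q p := by
            have h := hFpair (γ τ) q p (Ne.symm hne) hc'
            rwa [hG.collidePair_comm hne (le_of_eq (mem_contactSet.1 hc).2)] at h
          exact (hψ _ h2).trans (hq.trans le_add_self)
      · rw [indicator_of_notMem hen]
        exact bot_le
    calc ∑ e ∈ contactPairs (Torus.geometry (Fin 3)) ε (γ τ), E τ e = E τ (p, q) := hL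
      _ ≤ F (γ τ) p q + F (γ τ) q p := hEle
      _ ≤ ∑ i : Fin (N + 1), ∑ j : Fin (N + 1), F (γ τ) i j := hR
  rw [hlhs, hrhs]
  exact Finset.sum_le_sum hper

end Summit.AtomisticToContinuum.HydrodynamicLimit.Theorems.MaxSpeedBoundLogLine

end
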